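import Literature.NumberTheory.LFunctions.DeBruijnNewmanProofs

/-!
# RiemannHypothesis / UniversalFactor — the finite complex theta sum of de Bruijn's kernel `Φ`

Route `RiemannHypothesis/UniversalFactor`, item `MediumKernelNoGo` (stmt-RiemannHypothesis-2577),
line `one-sided-average-sign-test`, stub `stub_phiPartialC`.

The certified evaluation of `H_0(x') = ∫₀^∞ Φ(u) cos(x'u) du` by Gauss–Legendre quadrature in `u`
works with the finite theta sum
`S_N(w) = Σ_{n<N} (2π² (n+1)⁴ e^{9w} − 3π (n+1)² e^{5w}) exp(−π (n+1)² e^{4w})` as a function of a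
COMPLEX variable `w`; its Cauchy-estimate error bound needs three elementary facts, packaged in
`UniversalFactor.stub_phiPartialC`:

* `S_N` is entire (complex-differentiable everywhere);
* on the real axis `S_N(u) = Σ_{n<N} deBruijnPhiSummand n u`;
* the explicit majorant on horizontal lines
  `‖S_N(u + iv)‖ ≤ Σ_{n<N} (2π² (n+1)⁴ e^{9u} + 3π (n+1)² e^{5u}) exp(−π (n+1)² e^{4u} cos 4v)`.

All three are one-line consequences of `‖exp z‖ = e^{Re z}`, `Re (exp z) = e^{Re z} cos (Im z)` and the
triangle inequality.
-/

noncomputable section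

set_option linter.dupNamespace false

namespace Summit.RiemannHypothesis.RiemannHypothesis.Theorems

open MeasureTheory Set Complex
open Literature.NumberTheory.LFunctions

/-! ## One summand -/

/-- Norm of one complex theta summand on a horizontal line: for real `a, b ≥ 0` and real `c`,
`‖(a e^{9w} − b e^{5w}) exp(−c e^{4w})‖ ≤ (a e^{9 Re w} + b e^{5 Re w}) exp(−c e^{4 Re w} cos(4 Im w))`.
[folklore] -/
theorem UniversalFactor.phiPartialC_term_norm_le (a b c : ℝ) (ha : 0 ≤ a) (hb : 0 ≤ b) (w : ℂ) :
    ‖((a : ℂ) * Complex.exp (9 * w) - (b : ℂ) * Complex.exp (5 * w)) *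
        Complex.exp (-((c : ℂ) * Complex.exp (4 * w)))‖ ≤
      (a * Real.exp (9 * w.re) + b * Real.exp (5 * w.re)) *
        Real.exp (-(c * Real.exp (4 * w.re) * Real.cos (4 * w.im))) := by
  have hB : ‖Complex.exp (-((c : ℂ) * Complex.exp (4 * w)))‖ =
      Real.exp (-(c * Real.exp (4 * w.re) * Real.cos (4 * w.im))) := by
    rw [Complex.norm_exp]
    congr 1
    simp only [Complex.neg_re, Complex.mul_re, Complex.mul_im, Complex.ofReal_re, Complex.ofReal_im,
      Complex.exp_re, Complex.re_ofNat, Complex.im_ofNat, zero_mul, sub_zero, add_zero]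
    ring
  have hA1 : ‖(a : ℂ) * Complex.exp (9 * w)‖ = a * Real.exp (9 * w.re) := by
    rw [norm_mul, Complex.norm_real, Real.norm_of_nonneg ha, Complex.norm_exp]
    simp only [Complex.mul_re, Complex.re_ofNat, Complex.im_ofNat, zero_mul, sub_zero]
  have hA2 : ‖(b : ℂ) * Complex.exp (5 * w)‖ = b * Real.exp (5 * w.re) := by
    rw [norm_mul, Complex.norm_real, Real.norm_of_nonneg hb, Complex.norm_exp]
    simp only [Complex.mul_re, Complex.re_ofNat, Complex.im_ofNat, zero_mul, sub_zero]
  rw [norm_mul, hB, ← hA1, ← hA2]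
  exact mul_le_mul_of_nonneg_right (norm_sub_le _ _) (Real.exp_pos _).le

/-- One complex theta summand restricted to the real axis is `deBruijnPhiSummand n u`. [folklore] -/
theorem UniversalFactor.phiPartialC_term_ofReal (n : ℕ) (u : ℝ) :
    (2 * (Real.pi : ℂ) ^ 2 * ((n : ℂ) + 1) ^ 4 * Complex.exp (9 * (u : ℂ))
          - 3 * (Real.pi : ℂ) * ((n : ℂ) + 1) ^ 2 * Complex.exp (5 * (u : ℂ))) *
        Complex.exp (-((Real.pi : ℂ) * ((n : ℂ) + 1) ^ 2 * Complex.exp (4 * (u : ℂ)))) =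
      ((deBruijnPhiSummand n u : ℝ) : ℂ) := by
  simp only [deBruijnPhiSummand]
  push_cast
  ring

/-! ## The stub -/

/-- **Stub `stub_phiPartialC`** of the line `one-sided-average-sign-test` for `MediumKernelNoGo`:
the finite complex theta sum
`S_N(w) = Σ_{n<N} (2π² (n+1)⁴ e^{9w} − 3π (n+1)² e^{5w}) exp(−π (n+1)² e^{4w})` is entire, restricts
to `Σ_{n<N} deBruijnPhiSummand n` on `ℝ`, and satisfies
`‖S_N(w)‖ ≤ Σ_{n<N} (2π² (n+1)⁴ e^{9 Re w} + 3π (n+1)² e^{5 Re w}) exp(−π (n+1)² e^{4 Re w} cos(4 Im w))`.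
[folklore] -/
theorem UniversalFactor.stub_phiPartialC :
    ∀ N : ℕ,
    Differentiable ℂ (fun w : ℂ => ∑ n ∈ Finset.range N,
      (2 * (Real.pi : ℂ) ^ 2 * ((n : ℂ) + 1) ^ 4 * Complex.exp (9 * w)
          - 3 * (Real.pi : ℂ) * ((n : ℂ) + 1) ^ 2 * Complex.exp (5 * w)) *
        Complex.exp (-((Real.pi : ℂ) * ((n : ℂ) + 1) ^ 2 * Complex.exp (4 * w)))) ∧
    (∀ u : ℝ, (∑ n ∈ Finset.range N,
      (2 * (Real.pi : ℂ) ^ 2 * ((n : ℂ) + 1) ^ 4 * Complex.exp (9 * (u : ℂ))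
          - 3 * (Real.pi : ℂ) * ((n : ℂ) + 1) ^ 2 * Complex.exp (5 * (u : ℂ))) *
        Complex.exp (-((Real.pi : ℂ) * ((n : ℂ) + 1) ^ 2 * Complex.exp (4 * (u : ℂ))))) =
      ((∑ n ∈ Finset.range N, deBruijnPhiSummand n u : ℝ) : ℂ)) ∧
    (∀ w : ℂ, ‖∑ n ∈ Finset.range N,
      (2 * (Real.pi : ℂ) ^ 2 * ((n : ℂ) + 1) ^ 4 * Complex.exp (9 * w)
          - 3 * (Real.pi : ℂ) * ((n : ℂ) + 1) ^ 2 * Complex.exp (5 * w)) *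
        Complex.exp (-((Real.pi : ℂ) * ((n : ℂ) + 1) ^ 2 * Complex.exp (4 * w)))‖ ≤
      ∑ n ∈ Finset.range N,
        (2 * Real.pi ^ 2 * ((n : ℝ) + 1) ^ 4 * Real.exp (9 * w.re)
            + 3 * Real.pi * ((n : ℝ) + 1) ^ 2 * Real.exp (5 * w.re)) *
          Real.exp (-(Real.pi * ((n : ℝ) + 1) ^ 2 * Real.exp (4 * w.re) * Real.cos (4 * w.im)))) := by
  intro N
  refine ⟨?_, ?_, ?_⟩
  · fun_prop
  · intro u
    rw [Complex.ofReal_sum]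
    exact Finset.sum_congr rfl fun n _ => UniversalFactor.phiPartialC_term_ofReal n u
  · intro w
    refine (norm_sum_le _ _).trans (Finset.sum_le_sum fun n _ => ?_)
    have h1 : (2 * (Real.pi : ℂ) ^ 2 * ((n : ℂ) + 1) ^ 4) =
        ((2 * Real.pi ^ 2 * ((n : ℝ) + 1) ^ 4 : ℝ) : ℂ) := by push_cast; ring
    have h2 : (3 * (Real.pi : ℂ) * ((n : ℂ) + 1) ^ 2) =
        ((3 * Real.pi * ((n : ℝ) + 1) ^ 2 : ℝ) : ℂ) := by push_cast; ring
    have h3 : ((Real.pi : ℂ) * ((n : ℂ) + 1) ^ 2) =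
        ((Real.pi * ((n : ℝ) + 1) ^ 2 : ℝ) : ℂ) := by push_cast; ring
    rw [h1, h2, h3]
    exact UniversalFactor.phiPartialC_term_norm_le _ _ _ (by positivity) (by positivity) w

end Summit.RiemannHypothesis.RiemannHypothesis.Theorems
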